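import Summits.Ventures.PercRepro.RankLevelSetF
import Summits.Ventures.PercRepro.MatroidMidCount

/-!
# PercRepro — C-025: closure patterns of a single element and the counts of `M ＼ e`, `M ／ e` (night-1, gen 0)

`proofs/MINE2-RLS.md` §6, first half, in the kernel. For a non-loop `e` of a finite matroid `M`, with `E' = E ∖ {e}`,
every `A' ⊆ E'` has a CLOSURE PATTERN `(α, β) = ([e ∈ cl A'], [e ∈ cl(E' ∖ A')])`; `partCount M e a b α β` counts the
`A' ⊆ E'` with `r(A') = a`, `r(E' ∖ A') = b` and pattern `(α, β)` (mine-2's `n^{αβ}_{ab}`), and the `e`-FREE partitions are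
the pattern `(⊥, ⊥)`: `freeCount M e a b = partCount M e a b False False` (`n⁰⁰_{ab}`).

* `ncard_split`, `ncard_split4` — a finite family of sets splits along one / two predicates;
* `topCount_delete_eq` — `#U_{M∖e}(a, b)` = the four patterns at `(a, b)`;
* `contract_eRk_eq_iff_of_mem_closure` / `…_notMem_closure` — `r_{M/e}(X) = r_M(X) − [e ∈ cl X]` for `X ⊆ E'`;
* `topCount_contract_eq` — `#U_{M/e}(a, b)` = the patterns `(a+α, b+β; α, β)` (contracting `e` lowers the rank of a side
  by one exactly when `e` lies in its closure).
The identities (6.1), (6.2) with the cross term and the general induction step are in `RankLevelSetCrossStep`.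
Vocabulary: typer-2's `topCount` (`MatroidColoopStepA`). Axioms: standard.
-/
open scoped Matroid

namespace PercRepro

namespace Matroid

open Set

variable {α : Type} {M : _root_.Matroid α} {e : α}

/-- The `A' ⊆ E ∖ {e}` with `r(A') = a`, `r((E ∖ {e}) ∖ A') = b` and closure pattern `(ca, cb)`:
`e ∈ cl(A') ↔ ca`, `e ∈ cl((E ∖ {e}) ∖ A') ↔ cb`. -/
def partSet (M : _root_.Matroid α) (e : α) (a b : ℕ) (ca cb : Prop) : Set (Set α) :=
  {A : Set α | A ⊆ M.E \ {e} ∧ M.eRk A = (a : ℕ∞) ∧ M.eRk ((M.E \ {e}) \ A) = (b : ℕ∞) ∧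
    (e ∈ M.closure A ↔ ca) ∧ (e ∈ M.closure ((M.E \ {e}) \ A) ↔ cb)}

/-- `n^{αβ}_{ab}(e)` of mine-2 §6: the number of partitions of `E ∖ {e}` with ranks `(a, b)` and pattern `(ca, cb)`. -/
noncomputable def partCount (M : _root_.Matroid α) (e : α) (a b : ℕ) (ca cb : Prop) : ℕ :=
  (partSet M e a b ca cb).ncard

/-- `n⁰⁰_{ab}(e)`: the `e`-FREE partitions of `E ∖ {e}` with ranks `(a, b)` — `e` in neither closure. -/
noncomputable def freeCount (M : _root_.Matroid α) (e : α) (a b : ℕ) : ℕ :=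
  partCount M e a b False False

section Finite

variable [M.Finite]

/-- `partSet` is finite (a family of subsets of the finite ground set). -/
lemma partSet_finite (a b : ℕ) (ca cb : Prop) : (partSet M e a b ca cb).Finite :=
  (M.ground_finite.subset sdiff_subset).finite_subsets.subset (fun _ hA => hA.1)

/-- A finite family of sets splits along any predicate. -/
lemma ncard_split {S : Set (Set α)} (hS : S.Finite) (P : Set α → Prop) :
    S.ncard = {A | A ∈ S ∧ P A}.ncard + {A | A ∈ S ∧ ¬ P A}.ncard := by
  have h := ncard_inter_add_ncard_sdiff_eq_ncard S {A | P A} hS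
  rw [← h]
  congr 1

/-- A finite family of sets splits along two predicates into four pieces. -/
lemma ncard_split4 {S : Set (Set α)} (hS : S.Finite) (P Q : Set α → Prop) :
    S.ncard = {A | A ∈ S ∧ P A ∧ Q A}.ncard + {A | A ∈ S ∧ P A ∧ ¬ Q A}.ncard +
      {A | A ∈ S ∧ ¬ P A ∧ Q A}.ncard + {A | A ∈ S ∧ ¬ P A ∧ ¬ Q A}.ncard := by
  have hP : {A | A ∈ S ∧ P A}.Finite := hS.subset (fun _ hA => hA.1)
  have hnP : {A | A ∈ S ∧ ¬ P A}.Finite := hS.subset (fun _ hA => hA.1)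
  rw [ncard_split hS P, ncard_split hP Q, ncard_split hnP Q]
  have e1 : {A | A ∈ {A | A ∈ S ∧ P A} ∧ Q A} = {A | A ∈ S ∧ P A ∧ Q A} := by
    ext A; simp only [mem_setOf_eq]; tauto
  have e2 : {A | A ∈ {A | A ∈ S ∧ P A} ∧ ¬ Q A} = {A | A ∈ S ∧ P A ∧ ¬ Q A} := by
    ext A; simp only [mem_setOf_eq]; tauto
  have e3 : {A | A ∈ {A | A ∈ S ∧ ¬ P A} ∧ Q A} = {A | A ∈ S ∧ ¬ P A ∧ Q A} := by
    ext A; simp only [mem_setOf_eq]; tauto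
  have e4 : {A | A ∈ {A | A ∈ S ∧ ¬ P A} ∧ ¬ Q A} = {A | A ∈ S ∧ ¬ P A ∧ ¬ Q A} := by
    ext A; simp only [mem_setOf_eq]; tauto
  rw [e1, e2, e3, e4]
  ring

/-- Splitting a set of partitions of `E ∖ {e}` by the closure pattern gives the four `partCount`s. -/
lemma ncard_eq_sum_partCount (a b : ℕ) :
    {A : Set α | A ⊆ M.E \ {e} ∧ M.eRk A = (a : ℕ∞) ∧ M.eRk ((M.E \ {e}) \ A) = (b : ℕ∞)}.ncard =
      partCount M e a b True True + partCount M e a b True False +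
        partCount M e a b False True + partCount M e a b False False := by
  set S := {A : Set α | A ⊆ M.E \ {e} ∧ M.eRk A = (a : ℕ∞) ∧ M.eRk ((M.E \ {e}) \ A) = (b : ℕ∞)} with hS
  have hSfin : S.Finite := (M.ground_finite.subset sdiff_subset).finite_subsets.subset (fun _ hA => hA.1)
  rw [ncard_split4 hSfin (fun A => e ∈ M.closure A) (fun A => e ∈ M.closure ((M.E \ {e}) \ A))]
  unfold partCount partSet
  have e1 : {A | A ∈ S ∧ e ∈ M.closure A ∧ e ∈ M.closure ((M.E \ {e}) \ A)} =
      {A : Set α | A ⊆ M.E \ {e} ∧ M.eRk A = (a : ℕ∞) ∧ M.eRk ((M.E \ {e}) \ A) = (b : ℕ∞) ∧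
        (e ∈ M.closure A ↔ True) ∧ (e ∈ M.closure ((M.E \ {e}) \ A) ↔ True)} := by
    ext A; simp only [hS, mem_setOf_eq, iff_true]; tauto
  have e2 : {A | A ∈ S ∧ e ∈ M.closure A ∧ ¬ e ∈ M.closure ((M.E \ {e}) \ A)} =
      {A : Set α | A ⊆ M.E \ {e} ∧ M.eRk A = (a : ℕ∞) ∧ M.eRk ((M.E \ {e}) \ A) = (b : ℕ∞) ∧
        (e ∈ M.closure A ↔ True) ∧ (e ∈ M.closure ((M.E \ {e}) \ A) ↔ False)} := by
    ext A; simp only [hS, mem_setOf_eq, iff_true, iff_false]; tauto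
  have e3 : {A | A ∈ S ∧ ¬ e ∈ M.closure A ∧ e ∈ M.closure ((M.E \ {e}) \ A)} =
      {A : Set α | A ⊆ M.E \ {e} ∧ M.eRk A = (a : ℕ∞) ∧ M.eRk ((M.E \ {e}) \ A) = (b : ℕ∞) ∧
        (e ∈ M.closure A ↔ False) ∧ (e ∈ M.closure ((M.E \ {e}) \ A) ↔ True)} := by
    ext A; simp only [hS, mem_setOf_eq, iff_true, iff_false]; tauto
  have e4 : {A | A ∈ S ∧ ¬ e ∈ M.closure A ∧ ¬ e ∈ M.closure ((M.E \ {e}) \ A)} =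
      {A : Set α | A ⊆ M.E \ {e} ∧ M.eRk A = (a : ℕ∞) ∧ M.eRk ((M.E \ {e}) \ A) = (b : ℕ∞) ∧
        (e ∈ M.closure A ↔ False) ∧ (e ∈ M.closure ((M.E \ {e}) \ A) ↔ False)} := by
    ext A; simp only [hS, mem_setOf_eq, iff_false]; tauto
  simp only [e1, e2, e3, e4]

/-- **`#U_{M ＼ e}(a, b)` = the four patterns at `(a, b)`.** -/
theorem topCount_delete_eq (a b : ℕ) :
    topCount (M ＼ {e}) a b = partCount M e a b True True + partCount M e a b True False +
      partCount M e a b False True + partCount M e a b False False := by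
  rw [← ncard_eq_sum_partCount]
  unfold topCount
  congr 1
  ext A
  simp only [mem_setOf_eq, _root_.Matroid.delete_ground]
  constructor
  · rintro ⟨hA, h1, h2⟩
    rw [delete_singleton_eRk_eq hA] at h1
    rw [delete_singleton_eRk_eq sdiff_subset] at h2
    exact ⟨hA, h1, h2⟩
  · rintro ⟨hA, h1, h2⟩
    rw [delete_singleton_eRk_eq hA, delete_singleton_eRk_eq sdiff_subset]
    exact ⟨hA, h1, h2⟩

omit [M.Finite] in
/-- `r_M(insert e X) = r_M(X) + 1` when `e ∈ E` and `e ∉ cl(X)`. -/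
lemma eRk_insert_eq_add_one_of_notMem_closure {X : Set α} (heE : e ∈ M.E)
    (he : e ∉ M.closure X) : M.eRk (insert e X) = M.eRk X + 1 :=
  _root_.Matroid.eRk_insert_eq_add_one ⟨heE, he⟩

omit [M.Finite] in
/-- The rank in `M ／ {e}` of `X ⊆ E ∖ {e}`: `r_{M/e}(X) = r_M(X) − [e ∈ cl X]`, stated additively. -/
lemma contract_eRk_eq_of_mem_closure (he : M.Indep {e}) {X : Set α} (hX : X ⊆ M.E \ {e})
    (hcl : e ∈ M.closure X) : (M ／ {e}).eRk X + 1 = M.eRk X := by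
  rw [contract_singleton_eRk_add_one he hX, eRk_insert_eq_of_mem_closure (hX.trans sdiff_subset) hcl]

omit [M.Finite] in
/-- `r_{M/e}(X) = r_M(X)` when `e ∉ cl X` (`X ⊆ E ∖ {e}`). -/
lemma contract_eRk_eq_of_notMem_closure (he : M.Indep {e}) {X : Set α} (hX : X ⊆ M.E \ {e})
    (hcl : e ∉ M.closure X) : (M ／ {e}).eRk X = M.eRk X := by
  have heE : e ∈ M.E := he.subset_ground (mem_singleton e)
  have h := contract_singleton_eRk_add_one he hX
  rw [eRk_insert_eq_add_one_of_notMem_closure heE hcl] at h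
  exact ENat.add_left_injective_of_ne_top (by simp) h

omit [M.Finite] in
/-- `x + 1 = ↑(n + 1) ↔ x = ↑n` in `ℕ∞`. -/
lemma add_one_eq_coe_succ_iff {x : ℕ∞} {n : ℕ} : x + 1 = ((n + 1 : ℕ) : ℕ∞) ↔ x = (n : ℕ∞) := by
  constructor
  · exact eq_coe_of_add_one_eq
  · rintro rfl; push_cast; rfl

omit [M.Finite] in
/-- `r_{M/e}(X) = a ↔ r_M(X) = a + 1` when `e ∈ cl X` (`X ⊆ E ∖ {e}`, `e` a non-loop). -/
lemma contract_eRk_eq_iff_of_mem_closure (he : M.Indep {e}) {X : Set α} (hX : X ⊆ M.E \ {e})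
    (hcl : e ∈ M.closure X) (a : ℕ) : (M ／ {e}).eRk X = (a : ℕ∞) ↔ M.eRk X = ((a + 1 : ℕ) : ℕ∞) := by
  rw [← contract_eRk_eq_of_mem_closure he hX hcl, add_one_eq_coe_succ_iff]

omit [M.Finite] in
/-- `r_{M/e}(X) = a ↔ r_M(X) = a` when `e ∉ cl X`. -/
lemma contract_eRk_eq_iff_of_notMem_closure (he : M.Indep {e}) {X : Set α} (hX : X ⊆ M.E \ {e})
    (hcl : e ∉ M.closure X) (a : ℕ) : (M ／ {e}).eRk X = (a : ℕ∞) ↔ M.eRk X = (a : ℕ∞) := by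
  rw [contract_eRk_eq_of_notMem_closure he hX hcl]

/-- **`#U_{M ／ e}(a, b)`** (for a non-loop `e`): the patterns `(a+1, b+1; T, T)`, `(a+1, b; T, F)`,
`(a, b+1; F, T)`, `(a, b; F, F)` — contracting `e` lowers the rank of a side by one exactly when `e` is in
its closure. -/
theorem topCount_contract_eq (he : M.Indep {e}) (a b : ℕ) :
    topCount (M ／ {e}) a b = partCount M e (a + 1) (b + 1) True True + partCount M e (a + 1) b True False +
      partCount M e a (b + 1) False True + partCount M e a b False False := by
  unfold topCount
  set S := {A : Set α | A ⊆ (M ／ {e}).E ∧ (M ／ {e}).eRk A = (a : ℕ∞) ∧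
    (M ／ {e}).eRk ((M ／ {e}).E \ A) = (b : ℕ∞)} with hS
  have hE : (M ／ {e}).E = M.E \ {e} := _root_.Matroid.contract_ground M {e}
  have hSfin : S.Finite := by
    rw [hS, hE]
    exact (M.ground_finite.subset sdiff_subset).finite_subsets.subset (fun _ hA => hA.1)
  rw [ncard_split4 hSfin (fun A => e ∈ M.closure A) (fun A => e ∈ M.closure ((M.E \ {e}) \ A))]
  unfold partCount partSet
  have e1 : {A | A ∈ S ∧ e ∈ M.closure A ∧ e ∈ M.closure ((M.E \ {e}) \ A)} =
      {A : Set α | A ⊆ M.E \ {e} ∧ M.eRk A = ((a + 1 : ℕ) : ℕ∞) ∧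
        M.eRk ((M.E \ {e}) \ A) = ((b + 1 : ℕ) : ℕ∞) ∧
        (e ∈ M.closure A ↔ True) ∧ (e ∈ M.closure ((M.E \ {e}) \ A) ↔ True)} := by
    ext A
    simp only [hS, hE, mem_setOf_eq, iff_true]
    constructor
    · rintro ⟨⟨hA, h1, h2⟩, hc1, hc2⟩
      exact ⟨hA, (contract_eRk_eq_iff_of_mem_closure he hA hc1 a).1 h1,
        (contract_eRk_eq_iff_of_mem_closure he sdiff_subset hc2 b).1 h2, hc1, hc2⟩
    · rintro ⟨hA, h1, h2, hc1, hc2⟩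
      exact ⟨⟨hA, (contract_eRk_eq_iff_of_mem_closure he hA hc1 a).2 h1,
        (contract_eRk_eq_iff_of_mem_closure he sdiff_subset hc2 b).2 h2⟩, hc1, hc2⟩
  have e2 : {A | A ∈ S ∧ e ∈ M.closure A ∧ ¬ e ∈ M.closure ((M.E \ {e}) \ A)} =
      {A : Set α | A ⊆ M.E \ {e} ∧ M.eRk A = ((a + 1 : ℕ) : ℕ∞) ∧
        M.eRk ((M.E \ {e}) \ A) = (b : ℕ∞) ∧
        (e ∈ M.closure A ↔ True) ∧ (e ∈ M.closure ((M.E \ {e}) \ A) ↔ False)} := by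
    ext A
    simp only [hS, hE, mem_setOf_eq, iff_true, iff_false]
    constructor
    · rintro ⟨⟨hA, h1, h2⟩, hc1, hc2⟩
      exact ⟨hA, (contract_eRk_eq_iff_of_mem_closure he hA hc1 a).1 h1,
        (contract_eRk_eq_iff_of_notMem_closure he sdiff_subset hc2 b).1 h2, hc1, hc2⟩
    · rintro ⟨hA, h1, h2, hc1, hc2⟩
      exact ⟨⟨hA, (contract_eRk_eq_iff_of_mem_closure he hA hc1 a).2 h1,
        (contract_eRk_eq_iff_of_notMem_closure he sdiff_subset hc2 b).2 h2⟩, hc1, hc2⟩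
  have e3 : {A | A ∈ S ∧ ¬ e ∈ M.closure A ∧ e ∈ M.closure ((M.E \ {e}) \ A)} =
      {A : Set α | A ⊆ M.E \ {e} ∧ M.eRk A = (a : ℕ∞) ∧
        M.eRk ((M.E \ {e}) \ A) = ((b + 1 : ℕ) : ℕ∞) ∧
        (e ∈ M.closure A ↔ False) ∧ (e ∈ M.closure ((M.E \ {e}) \ A) ↔ True)} := by
    ext A
    simp only [hS, hE, mem_setOf_eq, iff_true, iff_false]
    constructor
    · rintro ⟨⟨hA, h1, h2⟩, hc1, hc2⟩
      exact ⟨hA, (contract_eRk_eq_iff_of_notMem_closure he hA hc1 a).1 h1,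
        (contract_eRk_eq_iff_of_mem_closure he sdiff_subset hc2 b).1 h2, hc1, hc2⟩
    · rintro ⟨hA, h1, h2, hc1, hc2⟩
      exact ⟨⟨hA, (contract_eRk_eq_iff_of_notMem_closure he hA hc1 a).2 h1,
        (contract_eRk_eq_iff_of_mem_closure he sdiff_subset hc2 b).2 h2⟩, hc1, hc2⟩
  have e4 : {A | A ∈ S ∧ ¬ e ∈ M.closure A ∧ ¬ e ∈ M.closure ((M.E \ {e}) \ A)} =
      {A : Set α | A ⊆ M.E \ {e} ∧ M.eRk A = (a : ℕ∞) ∧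
        M.eRk ((M.E \ {e}) \ A) = (b : ℕ∞) ∧
        (e ∈ M.closure A ↔ False) ∧ (e ∈ M.closure ((M.E \ {e}) \ A) ↔ False)} := by
    ext A
    simp only [hS, hE, mem_setOf_eq, iff_false]
    constructor
    · rintro ⟨⟨hA, h1, h2⟩, hc1, hc2⟩
      exact ⟨hA, (contract_eRk_eq_iff_of_notMem_closure he hA hc1 a).1 h1,
        (contract_eRk_eq_iff_of_notMem_closure he sdiff_subset hc2 b).1 h2, hc1, hc2⟩
    · rintro ⟨hA, h1, h2, hc1, hc2⟩
      exact ⟨⟨hA, (contract_eRk_eq_iff_of_notMem_closure he hA hc1 a).2 h1,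
        (contract_eRk_eq_iff_of_notMem_closure he sdiff_subset hc2 b).2 h2⟩, hc1, hc2⟩
  simp only [e1, e2, e3, e4]

end Finite

end Matroid

end PercRepro
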